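import Literature.MathematicalPhysics.StatisticalMechanics.LocalMatchingCompactness
import HarnessLib

/-!
# Route EnergyDerivativeOrder · LimitTransfer — helper III: transport to the local limit

Support lemmas for item stmt-AtomisticToContinuum-12284 (`LimitTransfer`). Setting: point sets
`T k ⊆ ℝᵈ` converging to `Y` in the local matching topology
(`∀ R' η > 0, ∀ᶠ k, BallMatch η R' 0 (T k) Y`, as produced by the tree's sequential compactness
`exists_subseq_forall_eventually_ballMatch`), `Y` being `δ`-separated. Then:

* `zero_mem_of_ballMatch` — if every `T k` contains the origin, so does `Y`;
* `dist_mem_of_ballMatch` — if, locally and eventually, the pair distances of `T k` come within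
  every `γ` of a set `D ⊆ ℝ` meeting every `[0, M]` in a finite set, then all pair distances of
  `Y` lie in `D`;
* `ncard_shell_of_ballMatch` — if, locally and eventually, every point of `T k` has exactly
  twelve other points of `T k` within `ρ` and no pair distance of `T k` lies in
  `(ρ − γ₀, ρ + γ₀)`, then every point of `Y` has exactly twelve other points of `Y` within `ρ`.

(The tree file `ThreeConeCertificateSlackRigidityLocalLimit.lean` has the first lemma and a
continuous-slack version of the second for the fixed separation `1/3`; here `δ` is general.)
All `[folklore]` (Baake–Grimm 2013, Remark 5.6, local rubber topology).
-/

noncomputable section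

namespace Summit.AtomisticToContinuum.Crystallization.Theorems.EnergyDerivativeOrderLimitTransfer

open scoped Topology
open Filter Set Metric
open Literature.MathematicalPhysics.StatisticalMechanics

variable {d : ℕ}

/-- `‖s‖ ≤ dist s y + ‖y‖`. [folklore] -/
theorem norm_le_dist_add_norm' (s y : EuclideanSpace ℝ (Fin d)) : ‖s‖ ≤ dist s y + ‖y‖ := by
  have h := dist_triangle s y 0
  rwa [dist_zero_right, dist_zero_right] at h

/-- **The root survives in the limit**: if every `T k` contains `0` and the limit `Y` is
`δ`-separated (`δ > 0`), then `0 ∈ Y`. [folklore] -/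
theorem zero_mem_of_ballMatch {T : ℕ → Set (EuclideanSpace ℝ (Fin d))}
    {Y : Set (EuclideanSpace ℝ (Fin d))} {δ : ℝ} (hδ : 0 < δ)
    (hYsep : ∀ p ∈ Y, ∀ q ∈ Y, p ≠ q → δ ≤ dist p q)
    (h0 : ∀ k, (0 : EuclideanSpace ℝ (Fin d)) ∈ T k)
    (hlim : ∀ R' η : ℝ, 0 < η → ∀ᶠ k in atTop, BallMatch η R' 0 (T k) Y) :
    (0 : EuclideanSpace ℝ (Fin d)) ∈ Y := by
  have hnear : ∀ η : ℝ, 0 < η → ∃ y ∈ Y, ‖y‖ ≤ η := by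
    intro η hη
    obtain ⟨k, hk⟩ := (hlim 0 η hη).exists
    obtain ⟨y, hy, hy0⟩ := hk.2 0 (h0 k) (by rw [dist_self])
    exact ⟨y, hy, by rwa [dist_zero_left] at hy0⟩
  obtain ⟨y₁, hy₁, hy₁n⟩ := hnear (δ / 3) (by positivity)
  by_contra h0Y
  have hy₁0 : y₁ ≠ 0 := fun h => h0Y (h ▸ hy₁)
  have hpos : 0 < ‖y₁‖ := norm_pos_iff.2 hy₁0
  obtain ⟨y₂, hy₂, hy₂n⟩ := hnear (‖y₁‖ / 2) (half_pos hpos)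
  have hne : y₂ ≠ y₁ := by
    intro h
    rw [h] at hy₂n
    linarith
  have h := hYsep y₂ hy₂ y₁ hy₁ hne
  have h' : dist y₂ y₁ ≤ ‖y₂‖ + ‖y₁‖ := dist_le_norm_add_norm _ _
  linarith

/-- Every point of the limit has partners: eventually `T k` has a point within `η` of `y ∈ Y`.
[folklore] -/
theorem eventually_exists_partner' {T : ℕ → Set (EuclideanSpace ℝ (Fin d))}
    {Y : Set (EuclideanSpace ℝ (Fin d))}
    (hlim : ∀ R' η : ℝ, 0 < η → ∀ᶠ k in atTop, BallMatch η R' 0 (T k) Y)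
    {y : EuclideanSpace ℝ (Fin d)} (hy : y ∈ Y) {η : ℝ} (hη : 0 < η) :
    ∀ᶠ k in atTop, ∃ s ∈ T k, dist s y ≤ η := by
  filter_upwards [hlim ‖y‖ η hη] with k hk
  exact hk.1 y hy (dist_zero_right y).le

/-- **Pair distances of the limit lie in the allowed set.** Let `D ⊆ ℝ` meet every `[0, M]` in
a finite set. If for every `L` and `γ > 0`, eventually in `k`, any two distinct points of `T k`
of norm `≤ L` are at a distance within `γ` of some element of `D`, then any two distinct points
of the `δ`-separated limit `Y` are at a distance belonging to `D`. [folklore] -/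
theorem dist_mem_of_ballMatch {T : ℕ → Set (EuclideanSpace ℝ (Fin d))}
    {Y : Set (EuclideanSpace ℝ (Fin d))} {D : Set ℝ} {δ : ℝ} (hδ : 0 < δ)
    (hYsep : ∀ p ∈ Y, ∀ q ∈ Y, p ≠ q → δ ≤ dist p q)
    (hlim : ∀ R' η : ℝ, 0 < η → ∀ᶠ k in atTop, BallMatch η R' 0 (T k) Y)
    (hfin : ∀ M : ℝ, (D ∩ Icc 0 M).Finite)
    (hpair : ∀ L γ : ℝ, 0 < γ → ∀ᶠ k in atTop, ∀ u ∈ T k, ∀ u' ∈ T k, ‖u‖ ≤ L → ‖u'‖ ≤ L →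
      u ≠ u' → ∃ t ∈ D, |dist u u' - t| < γ)
    {y y' : EuclideanSpace ℝ (Fin d)} (hy : y ∈ Y) (hy' : y' ∈ Y) (hne : y ≠ y') :
    dist y y' ∈ D := by
  set r := dist y y' with hr
  have hrδ : δ ≤ r := hYsep y hy y' hy' hne
  by_contra hrD
  -- a gap `γ₀ > 0` around `r` free of `D ∩ [0, r + 1]`
  set F := D ∩ Icc 0 (r + 1) with hF
  have hFfin : F.Finite := hfin (r + 1)
  obtain ⟨γ₀, hγ₀, hgap⟩ : ∃ γ₀ : ℝ, 0 < γ₀ ∧ ∀ t ∈ F, γ₀ ≤ |r - t| := by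
    rcases F.eq_empty_or_nonempty with hF0 | hFne
    · exact ⟨1, one_pos, fun t ht => by rw [hF0] at ht; exact absurd ht (notMem_empty t)⟩
    · obtain ⟨t₀, ht₀, hmin⟩ := Set.exists_min_image F (fun t => |r - t|) hFfin hFne
      refine ⟨|r - t₀|, ?_, hmin⟩
      rw [abs_pos, sub_ne_zero]
      rintro rfl
      exact hrD ht₀.1
  -- matching scale
  set γ := min (γ₀ / 4) (min (δ / 4) (1 / 4)) with hγ
  have hγ0 : 0 < γ := lt_min (by positivity) (lt_min (by positivity) (by norm_num))
  have hγ1 : γ ≤ γ₀ / 4 := min_le_left _ _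
  have hγ2 : γ ≤ δ / 4 := (min_le_right _ _).trans (min_le_left _ _)
  have hγ3 : γ ≤ 1 / 4 := (min_le_right _ _).trans (min_le_right _ _)
  have h1 := eventually_exists_partner' hlim hy hγ0
  have h2 := eventually_exists_partner' hlim hy' hγ0
  have h3 := hpair (‖y‖ + ‖y'‖ + 1) γ hγ0
  obtain ⟨k, ⟨u, hu, huy⟩, ⟨u', hu', hu'y'⟩, hk3⟩ := (h1.and (h2.and h3)).exists
  have huu' : u ≠ u' := by
    intro h
    rw [h] at huy
    have : r ≤ dist u' y + dist u' y' := dist_triangle_left _ _ _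
    linarith
  have huL : ‖u‖ ≤ ‖y‖ + ‖y'‖ + 1 := by
    have h := norm_le_dist_add_norm' u y
    linarith [norm_nonneg y']
  have hu'L : ‖u'‖ ≤ ‖y‖ + ‖y'‖ + 1 := by
    have h := norm_le_dist_add_norm' u' y'
    linarith [norm_nonneg y]
  obtain ⟨t, htD, ht⟩ := hk3 u hu u' hu' huL hu'L huu'
  have hclose : |dist u u' - r| ≤ 2 * γ := by
    have := dist_dist_dist_le u u' y y'
    rw [Real.dist_eq] at this
    linarith
  have hrt : |r - t| < 3 * γ := by
    rw [abs_lt] at ht ⊢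
    rw [abs_le] at hclose
    constructor <;> linarith [ht.1, ht.2, hclose.1, hclose.2]
  have htF : t ∈ F := by
    refine ⟨htD, ?_, ?_⟩
    · rw [abs_lt] at hrt
      linarith [hrt.1, hrt.2]
    · rw [abs_lt] at hrt
      linarith [hrt.1, hrt.2]
  have := hgap t htF
  linarith

/-- A `δ`-separated set meets every closed ball in a finite set. [folklore] -/
theorem finite_inter_closedBall_of_sep {Y : Set (EuclideanSpace ℝ (Fin d))} {δ : ℝ} (hδ : 0 < δ)
    (hYsep : ∀ p ∈ Y, ∀ q ∈ Y, p ≠ q → δ ≤ dist p q) (c : EuclideanSpace ℝ (Fin d)) (R : ℝ) :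
    (Y ∩ closedBall c R).Finite :=
  finite_of_forall_le_dist_of_subset_closedBall hδ
    (fun p hp q hq hpq => hYsep p hp.1 q hq.1 hpq) inter_subset_right

/-- **Twelve neighbours survive in the limit.** If for every `L`, eventually in `k`, every point
`u ∈ T k` of norm `≤ L` has exactly twelve other points of `T k` within `ρ`, and no two points of
`T k` of norm `≤ L` are at a distance in `(ρ − γ₀, ρ + γ₀)` (`γ₀ > 0`), the `T k` and the limit
`Y` being `δ`-separated, then every `y ∈ Y` has exactly twelve other points of `Y` within `ρ`.
[folklore] -/
theorem ncard_shell_of_ballMatch {T : ℕ → Set (EuclideanSpace ℝ (Fin d))}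
    {Y : Set (EuclideanSpace ℝ (Fin d))} {δ ρ γ₀ : ℝ} (hδ : 0 < δ) (hγ₀ : 0 < γ₀)
    (hsep : ∀ k, ∀ p ∈ T k, ∀ q ∈ T k, p ≠ q → δ ≤ dist p q)
    (hYsep : ∀ p ∈ Y, ∀ q ∈ Y, p ≠ q → δ ≤ dist p q)
    (hlim : ∀ R' η : ℝ, 0 < η → ∀ᶠ k in atTop, BallMatch η R' 0 (T k) Y)
    (hshell : ∀ L : ℝ, ∀ᶠ k in atTop, ∀ u ∈ T k, ‖u‖ ≤ L →
      {u' ∈ T k | u' ≠ u ∧ dist u u' ≤ ρ}.ncard = 12)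
    (hgapT : ∀ L : ℝ, ∀ᶠ k in atTop, ∀ u ∈ T k, ∀ u' ∈ T k, ‖u‖ ≤ L → ‖u'‖ ≤ L →
      ρ - γ₀ < dist u u' → dist u u' < ρ + γ₀ → False)
    {y : EuclideanSpace ℝ (Fin d)} (hy : y ∈ Y) :
    {y' ∈ Y | y' ≠ y ∧ dist y y' ≤ ρ}.ncard = 12 := by
  -- matching scale and radius
  set ε := min (δ / 3) (γ₀ / 3) with hε
  have hε0 : 0 < ε := lt_min (by positivity) (by positivity)
  have hεδ : ε ≤ δ / 3 := min_le_left _ _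
  have hεγ : ε ≤ γ₀ / 3 := min_le_right _ _
  set L := ‖y‖ + |ρ| + γ₀ + δ + 1 with hL
  have h1 := hlim L ε hε0
  have h2 := eventually_exists_partner' hlim hy hε0
  have h3 := hshell L
  have h4 := hgapT L
  obtain ⟨k, hk1, ⟨u, hu, huy⟩, hk3, hk4⟩ := (h1.and (h2.and (h3.and h4))).exists
  have hρabs : ρ ≤ |ρ| := le_abs_self ρ
  have huL : ‖u‖ ≤ L := by
    have h := norm_le_dist_add_norm' u y
    rw [hL]; linarith [abs_nonneg ρ]
  set SY := {y' ∈ Y | y' ≠ y ∧ dist y y' ≤ ρ} with hSY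
  set SU := {u' ∈ T k | u' ≠ u ∧ dist u u' ≤ ρ} with hSU
  have hSUcard : SU.ncard = 12 := hk3 u hu huL
  have hSUfin : SU.Finite := Set.finite_of_ncard_ne_zero (by rw [hSUcard]; norm_num)
  have hSYfin : SY.Finite := by
    refine (finite_inter_closedBall_of_sep hδ hYsep y ρ).subset ?_
    rintro y' ⟨hy'Y, -, hd⟩
    exact ⟨hy'Y, mem_closedBall.2 (by rwa [dist_comm])⟩
  -- norms of the points involved
  have hnormY : ∀ y' ∈ SY, ‖y'‖ ≤ ‖y‖ + |ρ| := by
    rintro y' ⟨-, -, hd⟩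
    have h := norm_le_dist_add_norm' y' y
    rw [dist_comm] at h
    linarith
  have hnormU : ∀ u' ∈ SU, ‖u'‖ ≤ L := by
    rintro u' ⟨-, -, hd⟩
    have h := norm_le_dist_add_norm' u' u
    rw [dist_comm] at h
    rw [hL]; linarith [norm_le_dist_add_norm' u y, abs_nonneg ρ]
  refine le_antisymm ?_ ?_
  · -- `SY ↪ SU` along the matching
    have hpart : ∀ y' ∈ SY, ∃ u' ∈ T k, dist u' y' ≤ ε := fun y' hy' =>
      hk1.1 y' hy'.1 (by rw [dist_zero_right]; linarith [hnormY y' hy', abs_nonneg ρ, hL])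
    choose! f hf using hpart
    have hfSU : ∀ y' ∈ SY, f y' ∈ SU := by
      intro y' hy'
      obtain ⟨hfT, hfd⟩ := hf y' hy'
      obtain ⟨hy'Y, hy'ne, hy'd⟩ := hy'
      have hδ' : δ ≤ dist y y' := hYsep y hy y' hy'Y (Ne.symm hy'ne)
      have hclose : |dist u (f y') - dist y y'| ≤ 2 * ε := by
        have := dist_dist_dist_le u (f y') y y'
        rw [Real.dist_eq] at this
        linarith
      rw [abs_le] at hclose
      have hne' : f y' ≠ u := by
        intro h
        rw [h, dist_self] at hclose
        linarith [hclose.1, hclose.2]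
      have hfL : ‖f y'‖ ≤ L := by
        have h := norm_le_dist_add_norm' (f y') y'
        rw [hL]; linarith [hnormY y' ⟨hy'Y, hy'ne, hy'd⟩, abs_nonneg ρ]
      have hle : dist u (f y') ≤ ρ := by
        by_contra hgt
        push Not at hgt
        exact hk4 u hu (f y') hfT huL hfL (by linarith) (by linarith [hclose.2])
      exact ⟨hfT, hne', hle⟩
    have hfinj : InjOn f SY := by
      intro y' hy' y'' hy'' hff
      by_contra hne'
      have h1' := (hf y' hy').2
      have h2' := (hf y'' hy'').2
      rw [hff] at h1'
      have hδ' := hYsep y' hy'.1 y'' hy''.1 hne'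
      have : dist y' y'' ≤ dist (f y'') y' + dist (f y'') y'' := dist_triangle_left _ _ _
      linarith
    calc SY.ncard ≤ SU.ncard := ncard_le_ncard_of_injOn f hfSU hfinj hSUfin
      _ = 12 := hSUcard
  · -- `SU ↪ SY` along the matching
    have hpart : ∀ u' ∈ SU, ∃ y' ∈ Y, dist u' y' ≤ ε := fun u' hu' =>
      hk1.2 u' hu'.1 (by rw [dist_zero_right]; exact hnormU u' hu')
    choose! g hg using hpart
    have hgSY : ∀ u' ∈ SU, g u' ∈ SY := by
      intro u' hu'
      obtain ⟨hgY, hgd⟩ := hg u' hu'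
      obtain ⟨hu'T, hu'ne, hu'd⟩ := hu'
      have hδ' : δ ≤ dist u u' := hsep k u hu u' hu'T (Ne.symm hu'ne)
      have hclose : |dist y (g u') - dist u u'| ≤ 2 * ε := by
        have := dist_dist_dist_le y (g u') u u'
        rw [Real.dist_eq, dist_comm y u, dist_comm (g u') u'] at this
        linarith
      rw [abs_le] at hclose
      have hne' : g u' ≠ y := by
        intro h
        rw [h, dist_self] at hclose
        linarith [hclose.1, hclose.2]
      -- the gap pushes `dist u u'` below `ρ - γ₀`
      have hlow : dist u u' ≤ ρ - γ₀ := by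
        by_contra hgt
        push Not at hgt
        exact hk4 u hu u' hu'T huL (hnormU u' ⟨hu'T, hu'ne, hu'd⟩) hgt (by linarith)
      exact ⟨hgY, hne', by linarith [hclose.2]⟩
    have hginj : InjOn g SU := by
      intro u' hu' u'' hu'' hgg
      by_contra hne'
      have h1' := (hg u' hu').2
      have h2' := (hg u'' hu'').2
      rw [hgg] at h1'
      have hδ' := hsep k u' hu'.1 u'' hu''.1 hne'
      have : dist u' u'' ≤ dist u' (g u'') + dist u'' (g u'') := dist_triangle_right _ _ _
      linarith
    calc 12 = SU.ncard := hSUcard.symm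
      _ ≤ SY.ncard := ncard_le_ncard_of_injOn g hgSY hginj hSYfin

end Summit.AtomisticToContinuum.Crystallization.Theorems.EnergyDerivativeOrderLimitTransfer

end
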